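/-
Copyright (c) 2026 the pub-hodgecm-mathlib formalisation cell (harness21).  Prover seat hodgecm-mathlib-K2E1-p08 (g4), Track B ∕ K2-LIT, h413 =
`stmt-HodgeConjecture-24833`, line `K2_E1_TraceFormulaBeta`, campaign «RES-RANK-ONE»; DEAL (FD-ASSEMBLY) of the dealer K2E1-plan (g2) 2026-09-04T03:08:27Z, companion of
`K2E1ResidualAdmissibleOfExponentsSmooth`: the BY-NAME forms — the socket statements `sig_K2E1ResidualCompactU2` (Sigs ED. 12 :247) and `sig_K2E1ResidualCompactU3R` (:293), bytes
verbatim, from the `∀ L μ`-package of (H4-b) exponent finiteness ALONE (the regularity input (H4-a) eliminated by ★ p857140 + `…Smooth`).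
-/
import Summits.HodgeConjecture.HodgeConjecture.Theorems.K2E1ResidualAdmissibleOfExponentsSmooth   -- ★ (this seat): `cmResidualSpectrumCompact_two_of_exp`, `cmResidualSpectrumCompactR_three_of_exp`
import HarnessLib

/-!
# K2·E1 — `K2E1ResidualAdmissibleOfExponentsSmoothSigs`: the sockets 5Res ∕ 12R3 BY NAME from (H4-b) EXPONENT FINITENESS ALONE

Track B ∕ K2-LIT, crux h413 = `stmt-HodgeConjecture-24833`, route of record `HCCMUnconditional`; cell `hodgecm-mathlib`, squad K2, ENGINE E1 (socket module
`K2_E1_TraceFormulaBetaSigs_GlobalIndex` ED. 12).  Prover seat `hodgecm-mathlib-K2E1-p08` (g4); DEAL «(H4-a) ELIMINATION» of the dealer K2E1-plan (g2) 2026-09-04T03:26:16Z, companion of ★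
`K2E1ResidualAdmissibleOfExponentsSmooth`.  THEOREMS ONLY (no `def`, no `instance`, no notation, no named-fact hypothesis, no `sorry`); lane `--supports stmt-HodgeConjecture-24833 --as helper`
(count-neutral).  CLOSES NO SOCKET.

WHAT.  `sig_K2E1ResidualCompactU2_of_exp` ∕ `sig_K2E1ResidualCompactU3R_of_exp`: the CONCLUSIONS are the Sigs ED. 12 statements :247 (`∀ L μ, CmResidualSpectrumCompact L 2 μ`) ∕ :293
(`∀ L μ, CmResidualSpectrumCompactR L 3 μ`) VERBATIM; the HYPOTHESIS is the `∀ L μ`-package «for every Borel structure on the radical there are a compact Hausdorff `K` with a continuous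
`ιK : K →* U(Φ_N)(𝔸_{L⁺})` (print: `K_∞K_f`), one Haar measure and one fundamental domain of `N(L⁺)` per radical, such that for every irreducible finite-dimensional `K`-type `E` of `L²_res|_K`
(H4-b) the constant terms of the continuous square-integrable representatives of the `E`-isotypic residual vectors lie in ONE finite-dimensional space of functions on `U(Φ_N)(𝔸_{L⁺})`»
[MoeglinWaldspurger1995 IV.1.11, V.3.13; Langlands1976 §7] — the finiteness clause of rank-one Eisenstein theory, ALONE (no regularity input: ★ `K2E1CentralTestFunctions` + ★ `…Smooth`).
Proof: put the Borel structure `borel` on the radicals and apply ★ `cmResidualSpectrumCompact_two_of_exp` ∕ ★ `cmResidualSpectrumCompactR_three_of_exp`.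
HONEST LABEL: HC_CM is proved only modulo the 7 printed citations (2 remaining named inputs: hLiu418 = `stmt-HodgeConjecture-24832`, h413 = `stmt-HodgeConjecture-24833`) until rung 0
closes; this file asserts no named fact and closes no socket — it is the kernel-checked reading «5Res ∕ 12R3 ⟸ (H4-b)».
References: [MoeglinWaldspurger1995] I.2.18, IV.1.11, V.3.13 · [Langlands1976] §7 · [HarishChandra1968] Thm. 1 · [BorelJacquet1979] §4.3–4.6 · [Rogawski1990] §13.5 pp. 204–206, §13.9 p. 227.
-/

set_option autoImplicit false
-- the mandated namespace repeats the single-problem summit's segment (`HodgeConjecture.HodgeConjecture`)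
set_option linter.dupNamespace false

noncomputable section

open MeasureTheory Measure Topology NumberField IsDedekindDomain
open Literature.NumberTheory.Automorphic Literature.NumberTheory.Automorphic.UnitaryGroup AdelicGroupData
open Summit.HodgeConjecture.HodgeConjecture.Cruxes.H413.K2E1CuspidalSpectrumUnitary
open Summit.HodgeConjecture.HodgeConjecture.Cruxes.H413.K2E1ResidualAdmissibleOfExponentsSmooth

namespace Summit.HodgeConjecture.HodgeConjecture.Cruxes.H413.K2E1ResidualAdmissibleOfExponentsSmoothSigs

/-- **SOCKET 5Res BY NAME: `sig_K2E1ResidualCompactU2` (Sigs ED. 12 :247, bytes verbatim) ⟸ the `∀ L μ`-package of (H4-b) ALONE** — for every CM field `L`, every automorphic `μ` and every Borel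
structure on the Siegel radical of `U(Φ₂)` there are `K →* U(Φ₂)(𝔸_{L⁺})` compact, a Haar measure and a fundamental domain of `N(L⁺)`, with exponent finiteness for every irreducible
finite-dimensional `K`-type of `L²_res|_K`. [cite: MoeglinWaldspurger1995, I.2.18 and V.3.13] [cite: HarishChandra1968, Thm. 1] [cite: Langlands1976, §7] -/
theorem sig_K2E1ResidualCompactU2_of_exp
    (h : ∀ (L : Type) [Field L] [NumberField L] [IsCMField L]
      (μ : Measure (UnitaryGroup.cmDatum L 2 (Matrix.of fun i j : Fin 2 => if i.val + j.val + 1 = 2 then (1 : L) else 0)).automorphicQuotient)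
      [(UnitaryGroup.cmDatum L 2 (Matrix.of fun i j : Fin 2 => if i.val + j.val + 1 = 2 then (1 : L) else 0)).IsAutomorphicMeasure μ]
      [∀ i, MeasurableSpace ((cmParabolicData L 2).radical i)] [∀ i, BorelSpace ((cmParabolicData L 2).radical i)],
      ∃ (K : Type) (_ : Group K) (_ : TopologicalSpace K) (_ : IsTopologicalGroup K) (_ : CompactSpace K) (_ : T2Space K)
        (ιK : K →* (UnitaryGroup.cmDatum L 2 (Matrix.of fun i j : Fin 2 => if i.val + j.val + 1 = 2 then (1 : L) else 0)).Adelic) (_ : Continuous ιK)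
        (νN : ∀ i, Measure ((cmParabolicData L 2).radical i)) (_ : ∀ i, (νN i).IsHaarMeasure)
        (𝓕 : ∀ i, Set ((cmParabolicData L 2).radical i)) (_ : ∀ i, IsFundamentalDomain ((cmParabolicData L 2).rational i) (𝓕 i) (νN i)),
        ∀ (E : Submodule ℂ (cmResidualSubspace L 2 μ).toSubmodule) (hE : ∀ k, ∀ x ∈ E, ((cmResidualSubspace L 2 μ).toContRep.restrict ιK) k x ∈ E),
          FiniteDimensional ℂ E → (((cmResidualSubspace L 2 μ).toContRep.restrict ιK).subRep E hE).IsIrreducible →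
          ∃ T : Submodule ℂ ((UnitaryGroup.cmDatum L 2 (Matrix.of fun i j : Fin 2 => if i.val + j.val + 1 = 2 then (1 : L) else 0)).Adelic → ℂ), FiniteDimensional ℂ T ∧
            ∀ w ∈ Representation.homRangeSum ((cmResidualSubspace L 2 μ).toContRep.restrict ιK).toRepresentation
                (((cmResidualSubspace L 2 μ).toContRep.restrict ιK).subRep E hE),
              ∀ ψ : (UnitaryGroup.cmDatum L 2 (Matrix.of fun i j : Fin 2 => if i.val + j.val + 1 = 2 then (1 : L) else 0)).automorphicQuotient → ℂ, Continuous ψ →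
                ∀ hψ : MemLp ψ 2 μ, hψ.toLp ψ = ((w : (cmResidualSubspace L 2 μ).toSubmodule) :
                    (UnitaryGroup.cmDatum L 2 (Matrix.of fun i j : Fin 2 => if i.val + j.val + 1 = 2 then (1 : L) else 0)).L2 μ) →
                  ∀ i, (fun x => ∫ u in 𝓕 i, ψ ((UnitaryGroup.cmDatum L 2 (Matrix.of fun i j : Fin 2 => if i.val + j.val + 1 = 2 then (1 : L) else 0)).toAutomorphicQuotient
                    (x * (u : (UnitaryGroup.cmDatum L 2 (Matrix.of fun i j : Fin 2 => if i.val + j.val + 1 = 2 then (1 : L) else 0)).Adelic)⁻¹)) ∂(νN i)) ∈ T) :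
    ∀ (L : Type) [Field L] [NumberField L] [IsCMField L]
      (μ : Measure (UnitaryGroup.cmDatum L 2 (Matrix.of fun i j : Fin 2 => if i.val + j.val + 1 = 2 then (1 : L) else 0)).automorphicQuotient)
      [(UnitaryGroup.cmDatum L 2 (Matrix.of fun i j : Fin 2 => if i.val + j.val + 1 = 2 then (1 : L) else 0)).IsAutomorphicMeasure μ],
      K2E1CuspidalSpectrumUnitary.CmResidualSpectrumCompact L 2 μ := by
  intro L _ _ _ μ _
  letI : ∀ i, MeasurableSpace ((cmParabolicData L 2).radical i) := fun i => borel _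
  haveI : ∀ i, BorelSpace ((cmParabolicData L 2).radical i) := fun i => ⟨rfl⟩
  obtain ⟨K, _, _, _, _, _, ιK, hι, νN, _, 𝓕, h𝓕, hexp⟩ := h L μ
  -- explicit form: the conclusion is the `∀ [MeasurableSpace] …`-quantified ★ socket predicate itself, not an instance of it
  exact @cmResidualSpectrumCompact_two_of_exp L _ _ _ μ _ _ _ K _ _ _ _ _ ιK hι νN _ 𝓕 h𝓕 hexp

/-- **SOCKET 12R3 BY NAME: `sig_K2E1ResidualCompactU3R` (Sigs ED. 12 :293, bytes verbatim) ⟸ the `∀ L μ`-package of (H4-b) ALONE** for the Heisenberg radical of record of `U(Φ₃)`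
(★ `cmParabolicDataR L 3`). [cite: MoeglinWaldspurger1995, I.2.18 and V.3.13] [cite: HarishChandra1968, Thm. 1] [cite: Langlands1976, §7] [cite: Rogawski1990, §13.9 p. 227] -/
theorem sig_K2E1ResidualCompactU3R_of_exp
    (h : ∀ (L : Type) [Field L] [NumberField L] [IsCMField L]
      (μ : Measure (UnitaryGroup.cmDatum L 3 (Matrix.of fun i j : Fin 3 => if i.val + j.val + 1 = 3 then (1 : L) else 0)).automorphicQuotient)
      [(UnitaryGroup.cmDatum L 3 (Matrix.of fun i j : Fin 3 => if i.val + j.val + 1 = 3 then (1 : L) else 0)).IsAutomorphicMeasure μ]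
      [∀ i, MeasurableSpace ((cmParabolicDataR L 3).radical i)] [∀ i, BorelSpace ((cmParabolicDataR L 3).radical i)],
      ∃ (K : Type) (_ : Group K) (_ : TopologicalSpace K) (_ : IsTopologicalGroup K) (_ : CompactSpace K) (_ : T2Space K)
        (ιK : K →* (UnitaryGroup.cmDatum L 3 (Matrix.of fun i j : Fin 3 => if i.val + j.val + 1 = 3 then (1 : L) else 0)).Adelic) (_ : Continuous ιK)
        (νN : ∀ i, Measure ((cmParabolicDataR L 3).radical i)) (_ : ∀ i, (νN i).IsHaarMeasure)
        (𝓕 : ∀ i, Set ((cmParabolicDataR L 3).radical i)) (_ : ∀ i, IsFundamentalDomain ((cmParabolicDataR L 3).rational i) (𝓕 i) (νN i)),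
        ∀ (E : Submodule ℂ (cmResidualSubspaceR L 3 μ).toSubmodule) (hE : ∀ k, ∀ x ∈ E, ((cmResidualSubspaceR L 3 μ).toContRep.restrict ιK) k x ∈ E),
          FiniteDimensional ℂ E → (((cmResidualSubspaceR L 3 μ).toContRep.restrict ιK).subRep E hE).IsIrreducible →
          ∃ T : Submodule ℂ ((UnitaryGroup.cmDatum L 3 (Matrix.of fun i j : Fin 3 => if i.val + j.val + 1 = 3 then (1 : L) else 0)).Adelic → ℂ), FiniteDimensional ℂ T ∧
            ∀ w ∈ Representation.homRangeSum ((cmResidualSubspaceR L 3 μ).toContRep.restrict ιK).toRepresentation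
                (((cmResidualSubspaceR L 3 μ).toContRep.restrict ιK).subRep E hE),
              ∀ ψ : (UnitaryGroup.cmDatum L 3 (Matrix.of fun i j : Fin 3 => if i.val + j.val + 1 = 3 then (1 : L) else 0)).automorphicQuotient → ℂ, Continuous ψ →
                ∀ hψ : MemLp ψ 2 μ, hψ.toLp ψ = ((w : (cmResidualSubspaceR L 3 μ).toSubmodule) :
                    (UnitaryGroup.cmDatum L 3 (Matrix.of fun i j : Fin 3 => if i.val + j.val + 1 = 3 then (1 : L) else 0)).L2 μ) →
                  ∀ i, (fun x => ∫ u in 𝓕 i, ψ ((UnitaryGroup.cmDatum L 3 (Matrix.of fun i j : Fin 3 => if i.val + j.val + 1 = 3 then (1 : L) else 0)).toAutomorphicQuotient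
                    (x * (u : (UnitaryGroup.cmDatum L 3 (Matrix.of fun i j : Fin 3 => if i.val + j.val + 1 = 3 then (1 : L) else 0)).Adelic)⁻¹)) ∂(νN i)) ∈ T) :
    ∀ (L : Type) [Field L] [NumberField L] [IsCMField L]
      (μ : Measure (UnitaryGroup.cmDatum L 3 (Matrix.of fun i j : Fin 3 => if i.val + j.val + 1 = 3 then (1 : L) else 0)).automorphicQuotient) [(UnitaryGroup.cmDatum L 3 (Matrix.of fun i j : Fin 3 => if i.val + j.val + 1 = 3 then (1 : L) else 0)).IsAutomorphicMeasure μ],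
      K2E1CuspidalSpectrumUnitary.CmResidualSpectrumCompactR L 3 μ := by
  intro L _ _ _ μ _
  letI : ∀ i, MeasurableSpace ((cmParabolicDataR L 3).radical i) := fun i => borel _
  haveI : ∀ i, BorelSpace ((cmParabolicDataR L 3).radical i) := fun i => ⟨rfl⟩
  obtain ⟨K, _, _, _, _, _, ιK, hι, νN, _, 𝓕, h𝓕, hexp⟩ := h L μ
  exact @cmResidualSpectrumCompactR_three_of_exp L _ _ _ μ _ _ _ K _ _ _ _ _ ιK hι νN _ 𝓕 h𝓕 hexp

end Summit.HodgeConjecture.HodgeConjecture.Cruxes.H413.K2E1ResidualAdmissibleOfExponentsSmoothSigs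

end
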